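import Summits.CriticalPhenomena.PercolationContinuityZ3.Theorems.Transplant.BSConj4BoxProdZ2OfSkeletonNode
import Summits.CriticalPhenomena.PercolationContinuityZ3.Theorems.Transplant.SkeletonDropNode
import HarnessLib

/-!
# Cartesian products inherit planar skeletons: `PlanarSkeleton Y → PlanarSkeleton (X □ Y)` for quasi-transitive `X`;
# growth and amenability of `X □ Y` for a factor `Y` of polynomial growth

builds on p205010 (kernel theorem, internal audit signed; external expert review pending) — nothing in this file uses p205010.
Lane `prim-bschramm`, seat `prim-bschramm-p4` (gen 3; class map, memo `P4-GENERAL.md` §11), helper file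
(`--supports stmt-CriticalPhenomena-4575`).

The lane's flagship closes `X □ ℤ²` for every quasi-transitive `X` from the node via the product skeleton `boxProdZ2Skeleton`
(`φ = Prod.snd`).  The same works with ANY skeleton-carrying second factor:
* `PlanarSkeleton.boxProdLeft X hq Φ : PlanarSkeleton (X □ Y)` — `φ = Φ.φ ∘ Prod.snd`, base vertices `V₀ × Φ.types`, frames and
  point group the products `boxProdIso γ α` of an `X`-automorphism with `Φ`'s frames / lifted point group; its cylinders are
  `univ ×ˢ Φ.cyl t ℓ` (`cyl_boxProdLeft`) — THICK fibres (all of `X` times the fibre of `Φ`), to be handled by the slab–quotient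
  criterion on the product (`BoxProdSlabQuotient.lean`);
* `not_hasExponentialGrowth_boxProd_of_polyGrowth` / `isGraphAmenable_boxProd_of_polyGrowth` — if `Y` has ball growth
  `≤ (2n+1)^D` and `X` is quasi-transitive of subexponential growth then `X □ Y` has subexponential growth, hence is amenable
  (Lyons–Peres §6.1; pattern of `BoxProdSubexponential.lean` with `ℤ^d ↦ Y`), so Burton–Keane gives uniqueness on `X □ Y`;
* `bsConj4_boxProd_case_expGrowth` — if `X` has exponential growth, Hutchcroft's theorem settles `X □ Y` outright.
[cite: BenjaminiSchramm1996, §2 (almost transitive graphs) and Conj. 4] [cite: LyonsPeres2016, §6.1 (p. 279)] [cite: Hutchcroft2016, Thm. 1]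
[cite: KozmaNitzan2024, §4 p. 15 (boxes and symmetries)]
-/

noncomputable section

namespace Summit.CriticalPhenomena.PercolationContinuityZ3.Theorems.Transplant

open MeasureTheory Filter Literature.Probability.Percolation Literature.Probability.LatticeModels
open Literature.Probability.Percolation.GM
open Literature.Barriers.CriticalPhenomena (IsQuasiTransitive IsGraphAmenable HasExponentialGrowth graphBall ballVolume
  graphBall_finite hasExponentialGrowth_of_not_isGraphAmenable Hutchcroft2016_noPercolationAtCriticality_holds
  BurtonKeane1989_atMostOneInfiniteCluster_holds)

variable {W U : Type}

/-! ## §1 The product skeleton -/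

/-- Along an edge of `X □ Y` the skeleton coordinate of the `Y`-component moves by at most one. [folklore] -/
theorem abs_phi_snd_sub_le_one (X : SimpleGraph W) {Y : SimpleGraph U} (Φ : PlanarSkeleton Y) {u v : W × U}
    (h : (X □ Y).Adj u v) (i : Fin 2) : |Φ.φ u.2 i - Φ.φ v.2 i| ≤ 1 := by
  rcases SimpleGraph.boxProd_adj.1 h with ⟨_, h2⟩ | ⟨h2, _⟩
  · rw [h2, sub_self, abs_zero]; exact zero_le_one
  · exact Φ.lip h2 i

/-- **The product skeleton `X □ Y`** from a planar skeleton of `Y` and quasi-transitivity of `X`: `φ = Φ.φ ∘ Prod.snd`, base vertices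
`V₀ × Φ.types`, frames `boxProdIso γ⁻¹ α`, point group `boxProdIso 1 α`. [cite: BenjaminiSchramm1996, §2 (almost transitive graphs)] -/
def PlanarSkeleton.boxProdLeft (X : SimpleGraph W) (hq : IsQuasiTransitive X) {Y : SimpleGraph U} (Φ : PlanarSkeleton Y) :
    PlanarSkeleton (X □ Y) where
  φ := fun v => Φ.φ v.2
  lip := fun _ _ h i => abs_phi_snd_sub_le_one X Φ h i
  types := (Classical.choose hq) ×ˢ Φ.types
  frame := by
    classical
    intro v
    obtain ⟨γ, hγ⟩ := Classical.choose_spec hq v.1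
    obtain ⟨t, ht, α, hαt, hα⟩ := Φ.frame v.2
    refine ⟨(γ v.1, t), Finset.mem_product.2 ⟨hγ, ht⟩, boxProdIso γ.symm α, ?_, fun w => ?_⟩
    · rw [boxProdIso_apply]; simp [hαt]
    · rw [boxProdIso_apply]; simp [hα]
  point := by
    classical
    intro t ht g
    obtain ⟨α, hαt, hα⟩ := Φ.point t.2 (Finset.mem_product.1 ht).2 g
    refine ⟨boxProdIso (SimpleGraph.Iso.refl (G := X)) α, ?_, fun w => ?_⟩
    · rw [boxProdIso_apply]; ext <;> simp [hαt]
    · rw [boxProdIso_apply]; simp [hα]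

/-- Base vertices of the product skeleton. [folklore] -/
theorem PlanarSkeleton.mem_types_boxProdLeft (X : SimpleGraph W) (hq : IsQuasiTransitive X) {Y : SimpleGraph U}
    (Φ : PlanarSkeleton Y) (t : W × U) : t ∈ (Φ.boxProdLeft X hq).types ↔ t.1 ∈ Classical.choose hq ∧ t.2 ∈ Φ.types :=
  Finset.mem_product

/-- **The cylinders of the product skeleton are `X × (cylinder of Φ)`** — thick fibres. [folklore] -/
theorem PlanarSkeleton.cyl_boxProdLeft (X : SimpleGraph W) (hq : IsQuasiTransitive X) {Y : SimpleGraph U}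
    (Φ : PlanarSkeleton Y) (t : W × U) (ℓ : ℕ) : (Φ.boxProdLeft X hq).cyl t ℓ = Set.univ ×ˢ Φ.cyl t.2 ℓ := by
  ext v; simp [PlanarSkeleton.cyl, PlanarSkeleton.boxProdLeft]

/-! ## §2 Growth and amenability of `X □ Y` for a factor of polynomial growth -/

/-- **Subexponential growth passes to `X □ Y` when `Y` grows polynomially** (`|B_Y(y,n)| ≤ (2n+1)^D`): if `X` does not have
exponential growth then neither has `X □ Y` (`|B_{X □ Y}| ≤ |B_X| · |B_Y|`). [cite: LyonsPeres2016, §6.1] -/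
theorem not_hasExponentialGrowth_boxProd_of_polyGrowth (X : SimpleGraph W) (Y : SimpleGraph U) [X.LocallyFinite]
    [Y.LocallyFinite] [Nonempty U] (D : ℕ) (hY : ∀ (y : U) (n : ℕ), ballVolume Y y n ≤ (2 * n + 1) ^ D)
    (hX : ¬ HasExponentialGrowth X) : ¬ HasExponentialGrowth (X □ Y) := by
  intro h
  apply hX
  intro w
  classical
  obtain ⟨y₀⟩ := ‹Nonempty U›
  obtain ⟨c, hc, hev⟩ := h (w, y₀)
  have hsc : 1 < Real.sqrt c := by
    rw [show (1 : ℝ) = Real.sqrt 1 by simp]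
    exact Real.sqrt_lt_sqrt (by norm_num) hc
  refine ⟨Real.sqrt c, hsc, ?_⟩
  have hpoly : ∀ᶠ n : ℕ in atTop, ((2 * n + 1 : ℕ) : ℝ) ^ D ≤ Real.sqrt c ^ n := by
    have hlim := (tendsto_pow_const_div_const_pow_of_one_lt D hsc).const_mul ((3 : ℝ) ^ D)
    rw [mul_zero] at hlim
    filter_upwards [hlim.eventually (gt_mem_nhds zero_lt_one), eventually_ge_atTop 1] with n hn hn1
    have hcn : (0 : ℝ) < Real.sqrt c ^ n := pow_pos (by linarith) n
    rw [← mul_div_assoc, div_lt_one hcn] at hn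
    have h3 : ((2 * n + 1 : ℕ) : ℝ) ^ D ≤ (3 : ℝ) ^ D * (n : ℝ) ^ D := by
      rw [← mul_pow]
      apply pow_le_pow_left₀ (by positivity)
      have : (1 : ℝ) ≤ n := by exact_mod_cast hn1
      push_cast; linarith
    linarith
  filter_upwards [hev, hpoly] with n hn hp
  have hvol : (ballVolume (X □ Y) (w, y₀) n : ℝ) ≤ ballVolume X w n * ((2 * n + 1 : ℕ) : ℝ) ^ D := by
    have h1 := ballVolume_boxProd_le X Y w y₀ n
    have h2 := hY y₀ n
    calc (ballVolume (X □ Y) (w, y₀) n : ℝ) ≤ (ballVolume X w n * ballVolume Y y₀ n : ℕ) := by exact_mod_cast h1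
      _ ≤ ballVolume X w n * ((2 * n + 1 : ℕ) : ℝ) ^ D := by
          push_cast
          exact mul_le_mul_of_nonneg_left (by exact_mod_cast h2) (by positivity)
  have hsq : c ^ n = Real.sqrt c ^ n * Real.sqrt c ^ n := by
    rw [← mul_pow, Real.mul_self_sqrt (by linarith)]
  have hpos : (0 : ℝ) < Real.sqrt c ^ n := pow_pos (by linarith) n
  by_contra hlt
  push Not at hlt
  have : (ballVolume (X □ Y) (w, y₀) n : ℝ) < c ^ n := by
    calc (ballVolume (X □ Y) (w, y₀) n : ℝ) ≤ ballVolume X w n * ((2 * n + 1 : ℕ) : ℝ) ^ D := hvol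
      _ ≤ ballVolume X w n * Real.sqrt c ^ n := mul_le_mul_of_nonneg_left hp (by positivity)
      _ < Real.sqrt c ^ n * Real.sqrt c ^ n := mul_lt_mul_of_pos_right hlt hpos
      _ = c ^ n := hsq.symm
  linarith

/-- **`X □ Y` is amenable** for quasi-transitive `X` of subexponential growth and quasi-transitive `Y` of polynomial growth (a
non-amenable quasi-transitive graph grows exponentially, tree `hasExponentialGrowth_of_not_isGraphAmenable`).
[cite: LyonsPeres2016, §6.1 (p. 279)] -/
theorem isGraphAmenable_boxProd_of_polyGrowth [DecidableEq W] [DecidableEq U] (X : SimpleGraph W) (Y : SimpleGraph U)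
    [X.LocallyFinite] [Y.LocallyFinite] [Nonempty U] (hqX : IsQuasiTransitive X) (hqY : IsQuasiTransitive Y) (D : ℕ)
    (hY : ∀ (y : U) (n : ℕ), ballVolume Y y n ≤ (2 * n + 1) ^ D) (hX : ¬ HasExponentialGrowth X) :
    IsGraphAmenable (X □ Y) := by
  by_contra h
  exact not_hasExponentialGrowth_boxProd_of_polyGrowth X Y D hY hX
    (hasExponentialGrowth_of_not_isGraphAmenable (X □ Y) (isQuasiTransitive_boxProd hqX hqY) h)

/-- **Uniqueness on `X □ Y`** in the same situation, for connected factors and every density (Burton–Keane on the connected,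
quasi-transitive, amenable product). [cite: BurtonKeane1989, Thm. 2] [cite: LyonsPeres2016, Thm. 7.6] -/
theorem numInfiniteClusters_le_one_boxProd_of_polyGrowth [DecidableEq W] [DecidableEq U] (X : SimpleGraph W) (Y : SimpleGraph U)
    [X.LocallyFinite] [Y.LocallyFinite] [Nonempty U] (hcX : X.Connected) (hcY : Y.Connected) (hqX : IsQuasiTransitive X)
    (hqY : IsQuasiTransitive Y) (D : ℕ) (hY : ∀ (y : U) (n : ℕ), ballVolume Y y n ≤ (2 * n + 1) ^ D)
    (hX : ¬ HasExponentialGrowth X) (p : unitInterval) :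
    ∀ᵐ ω ∂(bondPercolation (X □ Y) p), numInfiniteClusters ω ≤ 1 :=
  BurtonKeane1989_atMostOneInfiniteCluster_holds (X □ Y) (hcX.boxProd hcY) (isQuasiTransitive_boxProd hqX hqY)
    (isGraphAmenable_boxProd_of_polyGrowth X Y hqX hqY D hY hX) p

/-- **The exponential-growth branch is Hutchcroft's theorem**: if `X` has exponential growth then so has `X □ Y` and
`θ_{X □ Y}(v, p_c) = 0` at every vertex. [cite: Hutchcroft2016, Thm. 1] [cite: LyonsPeres2016, §6.1 (p. 279)] -/
theorem theta_boxProd_criticalProb_eq_zero_of_expGrowth (X : SimpleGraph W) (Y : SimpleGraph U) [X.LocallyFinite]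
    [Y.LocallyFinite] (hcX : X.Connected) (hcY : Y.Connected) (hqX : IsQuasiTransitive X) (hqY : IsQuasiTransitive Y)
    (hg : HasExponentialGrowth X) (v : W × U) : theta (X □ Y) v (criticalProbIOf (X □ Y) v) = 0 :=
  Hutchcroft2016_noPercolationAtCriticality_holds (X □ Y) (hcX.boxProd hcY) (isQuasiTransitive_boxProd hqX hqY)
    (hasExponentialGrowth_boxProd_left Y hg) v

end Summit.CriticalPhenomena.PercolationContinuityZ3.Theorems.Transplant

end
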